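import Literature.NumberTheory.QuadraticFields.ConjugateIdealClass
import Literature.NumberTheory.EllipticCurves.RingClassFieldDecompositionGroup
import HarnessLib

/-!
# The Kummer witness of a split prime: `γ = σ(β)^{p+1} β^{p-1}` for `𝔮^h = (β)`, `h = ord [𝔮]`,
# is not a `p`-th power in `K`, and "`γ` not a `p`-th power mod `ℓ`" forces `p^E ∣ ord [𝔮]_ℓ`
# (Cox, *Primes of the form x² + ny²*, §7.B–§7.D; Gross 1991, §3)

Topic `NumberTheory/QuadraticFields`, namespace `Literature.NumberTheory.QuadraticFields.RingClass`
(continuing `RingClassPrimeConductorOrder.lean`). Theorems only — no definition, no named fact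
(D-0026); unconditional.

Let `K` be an imaginary quadratic field with `d_K < -4` (`𝒪_K^× = {±1}`), `σ` its non-trivial
automorphism, `p ≥ 3` a prime, and `q` a rational prime SPLIT in `K`: `(q) = 𝔮 · σ𝔮`, `𝔮 ≠ σ𝔮`.
Let `h` be the order of `[𝔮]` in `Cl(𝒪_K)` and `𝔮^h = (β)` (so `(σ𝔮)^h = (σβ)`). The element
**`γ := (σβ)^{p+1} β^{p-1} ∈ 𝒪_K`** has:

* `N_{K/ℚ}(γ) = (N(β)^2)^p` (`norm_kummerWitness`) — a `p`-th power in `ℚ`;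
* **`γ ∉ K^{×p}`** (`not_exists_pow_eq_kummerWitness`): if `γ = y^p` then `β a^p = σβ · c^p` in
  `𝒪_K` for some `a, c ≠ 0`; comparing `𝔮`-adic multiplicities (`𝔮 ∤ σβ`) gives `p ∣ h`, `h = p h'`,
  and then `(𝔮^{h'} (a))^p = ((σ𝔮)^{h'} (c))^p`, so `𝔮^{h'}(a) = (σ𝔮)^{h'}(c)` (unique factorisation
  of ideals) and `[𝔮]^{h'} = [σ𝔮]^{h'} = [𝔮]^{-h'}` (Cox §7.B: `[σ𝔮] = [𝔮]^{-1}`, the tree's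
  `mk0_mul_mk0_smul_eq_one`), i.e. `[𝔮]^{2h'} = 1`, `p h' ∣ 2 h'`, `p ∣ 2` — absurd;
* the residue translation (`exists_pow_sub_kummerWitness_mem`: `β ≡ u^p ⟹ γ ≡ (σ(u)^{p+1} u^{p-1})^p`
  modulo `ℓ𝒪_K`) and Euler's criterion in the cyclic group `(𝒪_K/ℓ)^× ≅ 𝔽_{ℓ²}^×` for an inert `ℓ`
  (`exists_pow_sub_mem_span_of_pow_div_sub_one_mem`: `β^{(ℓ²-1)/p} ≡ 1 ⟹ β ≡ u^p`).

The residue law and the assembled statement `SplitPrimeKummerWitness K p q` of the auxiliary-norm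
line on Heegner points (crux `EulerHalfNotRamNoInertSetAtFive`, stub (O)) are the sequel
`SplitPrimeKummerWitnessOrder.lean` (which adds the prime-conductor order lemma of
`RingClassPrimeConductorOrder.lean`); this file is the `q`-adic / class-group half.

## References

* D. A. Cox, *Primes of the form x² + ny²*, 2nd ed., Wiley (2013): §7.B (conjugate ideals; `[𝔞̄] =
  [𝔞]^{-1}`), §7.C Prop. 7.22, §7.D (7.27), Thm. 7.24. [Cox2013]
* B. H. Gross, *Kolyvagin's work on modular elliptic curves*, LMS LNS 153 (1991), §3 (p. 239:
  `G_ℓ ≃ F_λ^×/F_ℓ^×`). [GrossLMS1991]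
* D. A. Marcus, *Number Fields*, 2nd ed. (2018), Ch. 3, Thm. 25 (splitting in quadratic fields).
  [Marcus2018]

## Mathlib / tree search

Tree (by name): `card_quot_span_natCast_eq_sq` (`RingClassGroupTower`), `mk0_mul_mk0_smul_eq_one`,
`eq_one_or_eq_of_card_eq_two`, `smul_asIdeal_mem_nonZeroDivisors` (`ConjugateIdealClass`),
`orderOf_primeClass_eq_of_smul` (`EllipticCurves/RingClassFieldDecompositionGroup`),
`intCast_mem_span_iff`, `exists_basis_zero_eq_one` (`RingClassNumber`, `HeegnerCondition`).
Mathlib: `emultiplicity_mul`, `emultiplicity_pow`, `emultiplicity_pow_self`, `emultiplicity_eq_zero`,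
`FiniteMultiplicity.of_prime_left`, `normalizedFactors_pow`, `Ideal.prod_normalizedFactors_eq_self`,
`nsmul_right_injective` (`IsAddTorsionFree (Multiset _)`), `ClassGroup.mk0_eq_one_iff`,
`Ideal.exists_smul_eq_of_isGaloisGroup`, `Algebra.norm_eq_of_algEquiv`, `IsFractionRing.div_surjective`,
`IsCyclic.exists_generator`, `Nat.card_units`. `lean search 'Kummer witness|not a p-th power.*quadratic'`
(2026-08-28): nothing in the tree beyond the consumer stub.
-/

noncomputable section

open scoped nonZeroDivisors NumberField Pointwise Classical
open Module NumberField IsDedekindDomain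

namespace Literature.NumberTheory.QuadraticFields.RingClass

open Literature.NumberTheory.NumberFields.RingClassField
open Literature.NumberTheory.QuadraticFields.Quadratic
open Literature.NumberTheory.EllipticCurves

variable {K : Type} [Field K] [NumberField K]

/-! ### §0. Plumbing -/

omit [NumberField K] in
/-- `p`-th roots of ideals are unique in a Dedekind domain: `I^n = J^n`, `n ≠ 0` ⟹ `I = J`
(unique factorisation). [folklore] -/
private theorem eq_of_pow_eq_pow_ideal [NumberField K] {I J : Ideal (𝓞 K)} (hI : I ≠ ⊥) (hJ : J ≠ ⊥)
    {n : ℕ} (hn : n ≠ 0) (h : I ^ n = J ^ n) : I = J := by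
  have hf := congrArg UniqueFactorizationMonoid.normalizedFactors h
  rw [UniqueFactorizationMonoid.normalizedFactors_pow,
    UniqueFactorizationMonoid.normalizedFactors_pow] at hf
  have hf' := nsmul_right_injective hn hf
  rw [← Ideal.prod_normalizedFactors_eq_self hI, ← Ideal.prod_normalizedFactors_eq_self hJ, hf']

omit [NumberField K] in
/-- A prime of `𝓞_K` containing a rational prime `q` lies above `(q) ⊂ ℤ`. [folklore] -/
private theorem under_int_eq_span_of_natCast_mem' {q : ℕ} (hq : q.Prime) {P : Ideal (𝓞 K)}
    [P.IsPrime] (hqP : (q : 𝓞 K) ∈ P) : P.under ℤ = Ideal.span {(q : ℤ)} := by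
  have hmax : (Ideal.span {(q : ℤ)}).IsMaximal :=
    PrincipalIdealRing.isMaximal_of_irreducible (Nat.prime_iff_prime_int.mp hq).irreducible
  refine (hmax.eq_of_le (Ideal.IsPrime.under ℤ P).ne_top ?_).symm
  rw [Ideal.span_singleton_le_iff_mem, Ideal.mem_comap, map_natCast]
  exact hqP

/-- The Galois action on `𝓞_K` maps `(β)` to `(σβ)`. [folklore] -/
private theorem smul_span_singleton (τ : K ≃ₐ[ℚ] K) (β : 𝓞 K) :
    τ • (Ideal.span {β} : Ideal (𝓞 K)) = Ideal.span {τ • β} := by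
  rw [Ideal.pointwise_smul_def, Ideal.map_span, Set.image_singleton]
  rfl

/-- The Galois action fixes `ℓ𝓞_K`. [folklore] -/
private theorem smul_span_natCast (τ : K ≃ₐ[ℚ] K) (ℓ : ℕ) :
    τ • (Ideal.span {(ℓ : 𝓞 K)} : Ideal (𝓞 K)) = Ideal.span {(ℓ : 𝓞 K)} := by
  rw [smul_span_singleton]
  congr 2
  exact map_natCast (MulSemiringAction.toRingHom (K ≃ₐ[ℚ] K) (𝓞 K) τ) ℓ

/-! ### §1. Residues modulo an inert prime: `p`-th powers in `(𝒪_K/ℓ)^× ≅ 𝔽_{ℓ²}^×` -/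

/-- **Euler's criterion for `p`-th powers in `𝒪_K/ℓ𝒪_K`** (`ℓ` inert in the quadratic field `K`,
`#(𝒪_K/ℓ) = ℓ²`, `p ∣ ℓ² - 1`): if `β ∉ ℓ𝒪_K` and `β^{(ℓ²-1)/p} ≡ 1 (mod ℓ𝒪_K)` then
`β ≡ u^p (mod ℓ𝒪_K)` for some `u` — the unit group of the finite field `𝒪_K/ℓ` is cyclic of order
`ℓ² - 1`. [cite: GrossLMS1991, §3 (p. 239: F_λ has ℓ² elements, F_λ^× cyclic)]
[cite: Cox2013, §7.D (7.27)] -/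
theorem exists_pow_sub_mem_span_of_pow_div_sub_one_mem (h2 : finrank ℚ K = 2) {ℓ : ℕ} (hℓ : ℓ.Prime)
    (hℓP : (Ideal.span {(ℓ : 𝓞 K)}).IsPrime) {p : ℕ} (hp : p.Prime) (hpℓ : p ∣ ℓ ^ 2 - 1)
    {β : 𝓞 K} (hβ : β ∉ Ideal.span {(ℓ : 𝓞 K)})
    (h1 : β ^ ((ℓ ^ 2 - 1) / p) - 1 ∈ Ideal.span {(ℓ : 𝓞 K)}) :
    ∃ u : 𝓞 K, u ^ p - β ∈ Ideal.span {(ℓ : 𝓞 K)} := by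
  set L : Ideal (𝓞 K) := Ideal.span {(ℓ : 𝓞 K)} with hL
  have hne : L ≠ ⊥ := by
    rw [hL, Ne, Ideal.span_singleton_eq_bot]; exact_mod_cast hℓ.ne_zero
  haveI hmax : L.IsMaximal := hℓP.isMaximal hne
  letI : Field (𝓞 K ⧸ L) := Ideal.Quotient.field L
  haveI : Finite (𝓞 K ⧸ L) := Ideal.finiteQuotientOfFreeOfNeBot L hne
  haveI : Fintype (𝓞 K ⧸ L) := Fintype.ofFinite _
  obtain ⟨b, -⟩ := exists_basis_zero_eq_one (K := K) h2
  have hcard : Nat.card (𝓞 K ⧸ L)ˣ = ℓ ^ 2 - 1 := by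
    rw [Nat.card_units, card_quot_span_natCast_eq_sq b ℓ]
  set x : 𝓞 K ⧸ L := Ideal.Quotient.mk L β with hx
  have hx0 : x ≠ 0 := by
    rw [hx, Ne, Ideal.Quotient.eq_zero_iff_mem]; exact hβ
  set xu : (𝓞 K ⧸ L)ˣ := Units.mk0 x hx0 with hxu
  -- `x ^ ((ℓ²-1)/p) = 1`
  have hxpow : xu ^ ((ℓ ^ 2 - 1) / p) = 1 := by
    apply Units.ext
    rw [Units.val_pow_eq_pow_val, hxu, Units.val_mk0, Units.val_one, hx, ← map_pow,
      ← (Ideal.Quotient.mk L).map_one, Ideal.Quotient.eq]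
    exact h1
  -- a generator `g` of the cyclic unit group; `xu = g ^ s` with `p ∣ s`
  obtain ⟨g, hg⟩ := IsCyclic.exists_generator (α := (𝓞 K ⧸ L)ˣ)
  have hordg : orderOf g = ℓ ^ 2 - 1 := (orderOf_eq_card_of_forall_mem_zpowers hg).trans hcard
  obtain ⟨s, hs⟩ : ∃ s : ℕ, g ^ s = xu := by
    have hmem : xu ∈ Subgroup.zpowers g := hg xu
    rwa [← mem_powers_iff_mem_zpowers] at hmem
  have hNp : 0 < (ℓ ^ 2 - 1) / p := by
    refine Nat.div_pos (Nat.le_of_dvd ?_ hpℓ) hp.pos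
    have h4 : 2 ^ 2 ≤ ℓ ^ 2 := Nat.pow_le_pow_left hℓ.two_le 2
    omega
  have hps : p ∣ s := by
    have h3 : orderOf g ∣ s * ((ℓ ^ 2 - 1) / p) := by
      rw [orderOf_dvd_iff_pow_eq_one, pow_mul, hs, hxpow]
    rw [hordg] at h3
    have h4 : p * ((ℓ ^ 2 - 1) / p) ∣ s * ((ℓ ^ 2 - 1) / p) := by
      rwa [Nat.mul_div_cancel' hpℓ]
    exact Nat.dvd_of_mul_dvd_mul_right hNp h4
  obtain ⟨t, rfl⟩ := hps
  -- `u = g ^ t` lifted to `𝓞_K`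
  obtain ⟨u, hu⟩ := Ideal.Quotient.mk_surjective (((g ^ t : (𝓞 K ⧸ L)ˣ) : 𝓞 K ⧸ L))
  refine ⟨u, ?_⟩
  rw [← Ideal.Quotient.eq, map_pow, hu, ← Units.val_pow_eq_pow_val, ← pow_mul, mul_comm, hs, hxu,
    Units.val_mk0]

/-- If `β ≡ u^p (mod ℓ𝒪_K)` then `σβ ≡ (σu)^p (mod ℓ𝒪_K)` for every automorphism `σ` of `K`.
[folklore] -/
private theorem smul_pow_sub_smul_mem (τ : K ≃ₐ[ℚ] K) {u β : 𝓞 K} {ℓ p : ℕ}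
    (h : u ^ p - β ∈ Ideal.span {(ℓ : 𝓞 K)}) :
    (τ • u) ^ p - τ • β ∈ Ideal.span {(ℓ : 𝓞 K)} := by
  have h1 : τ • (u ^ p - β) ∈ τ • (Ideal.span {(ℓ : 𝓞 K)} : Ideal (𝓞 K)) :=
    Ideal.smul_mem_pointwise_smul_iff.mpr h
  rwa [smul_span_natCast, smul_sub, smul_pow'] at h1

/-- **Residue translation**: if `β` is a `p`-th power modulo `ℓ𝒪_K` then so is the Kummer witness
`γ = (σβ)^{p+1} β^{p-1}` (`γ ≡ ((σu)^{p+1} u^{p-1})^p`; the automorphism `σ` preserves `ℓ𝒪_K`).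
[cite: Cox2013, §7.B (the conjugation of 𝒪_K and conjugate ideals)] -/
theorem exists_pow_sub_kummerWitness_mem (τ : K ≃ₐ[ℚ] K) {u β : 𝓞 K} {ℓ p : ℕ}
    (h : u ^ p - β ∈ Ideal.span {(ℓ : 𝓞 K)}) :
    ∃ y : 𝓞 K, y ^ p - (τ • β) ^ (p + 1) * β ^ (p - 1) ∈ Ideal.span {(ℓ : 𝓞 K)} := by
  refine ⟨(τ • u) ^ (p + 1) * u ^ (p - 1), ?_⟩
  have h' := smul_pow_sub_smul_mem τ h
  rw [← Ideal.Quotient.eq] at h h' ⊢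
  simp only [map_pow, map_mul] at h h' ⊢
  rw [← h, ← h']
  ring

/-! ### §2. The norm of the Kummer witness -/

/-- **`N_{K/ℚ}((σβ)^{p+1} β^{p-1}) = (N(β)²)^p`** (`N(σβ) = N(β)`: the norm is the product over the two
embeddings, permuted by `σ`). [cite: Cox2013, §7.A (the norm N(α) = α·α' of a quadratic field)]
[cite: Marcus2018, Ch. 2 (norm and conjugates)] -/
theorem norm_kummerWitness (τ : K ≃ₐ[ℚ] K) (β : 𝓞 K) (p : ℕ) (hp : 1 ≤ p) :
    Algebra.norm ℚ ((((τ • β) ^ (p + 1) * β ^ (p - 1) : 𝓞 K) : K)) =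
      (Algebra.norm ℚ (β : K) ^ 2) ^ p := by
  have hτ : Algebra.norm ℚ (((τ • β : 𝓞 K)) : K) = Algebra.norm ℚ (β : K) := by
    have hc : ((τ • β : 𝓞 K) : K) = τ (β : K) := rfl
    rw [hc]
    exact Algebra.norm_eq_of_algEquiv τ (β : K)
  simp only [map_mul, map_pow, hτ]
  rw [← pow_add, ← pow_mul]
  congr 1
  omega

/-! ### §3. The Kummer witness is not a `p`-th power in `K` -/

/-- **`p ∣ h` from `β a^p = β' c^p`**: if `𝔮 ≠ 𝔮'` are primes of `𝒪_K`, `𝔮^h = (β)`, `𝔮'^h = (β')`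
and `β a^p = β' c^p` with `a, c ≠ 0`, then `p ∣ h` — compare `𝔮`-adic multiplicities:
`h + p·v_𝔮(a) = p·v_𝔮(c)` (`𝔮 ∤ β'`; unique factorisation of ideals in the Dedekind domain `𝒪_K`).
[cite: Marcus2018, Ch. 3, Thm. 16 (unique factorisation of ideals)] [cite: Cox2013, §5.B, §7.A (Dedekind domains)] -/
theorem dvd_of_mul_pow_eq_mul_pow {𝔮 𝔮' : HeightOneSpectrum (𝓞 K)} (hne : 𝔮.asIdeal ≠ 𝔮'.asIdeal)
    {β β' a c : 𝓞 K} {h p : ℕ} (hβ : 𝔮.asIdeal ^ h = Ideal.span {β})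
    (hβ' : 𝔮'.asIdeal ^ h = Ideal.span {β'}) (ha : a ≠ 0) (hc : c ≠ 0)
    (heq : β * a ^ p = β' * c ^ p) : p ∣ h := by
  have hQ : Prime 𝔮.asIdeal := 𝔮.prime
  have hQu : ¬ IsUnit 𝔮.asIdeal := Ideal.isUnit_iff.not.mpr 𝔮.isPrime.ne_top
  -- `𝔮 ∤ 𝔮'^h`
  have hndvd : ¬ 𝔮.asIdeal ∣ 𝔮'.asIdeal ^ h := by
    intro hd
    rw [Ideal.dvd_iff_le] at hd
    haveI := 𝔮.isPrime
    exact hne (𝔮'.isMaximal.eq_of_le 𝔮.isPrime.ne_top (Ideal.IsPrime.le_of_pow_le hd)).symm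
  -- finite multiplicities of `(a)`, `(c)`
  have hsa : (Ideal.span {a} : Ideal (𝓞 K)) ≠ 0 := Submodule.span_singleton_eq_bot.mp.mt ha
  have hsc : (Ideal.span {c} : Ideal (𝓞 K)) ≠ 0 := Submodule.span_singleton_eq_bot.mp.mt hc
  have hfa : FiniteMultiplicity 𝔮.asIdeal (Ideal.span {a}) := FiniteMultiplicity.of_prime_left hQ hsa
  have hfc : FiniteMultiplicity 𝔮.asIdeal (Ideal.span {c}) := FiniteMultiplicity.of_prime_left hQ hsc
  have e1 : emultiplicity 𝔮.asIdeal (Ideal.span {β * a ^ p} : Ideal (𝓞 K)) =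
      (h : ℕ∞) + p * (multiplicity 𝔮.asIdeal (Ideal.span {a}) : ℕ) := by
    rw [← Ideal.span_singleton_mul_span_singleton, emultiplicity_mul hQ, ← Ideal.span_singleton_pow,
      emultiplicity_pow hQ, ← hβ, emultiplicity_pow_self 𝔮.ne_bot hQu, hfa.emultiplicity_eq_multiplicity]
  have e2 : emultiplicity 𝔮.asIdeal (Ideal.span {β' * c ^ p} : Ideal (𝓞 K)) =
      (p : ℕ∞) * (multiplicity 𝔮.asIdeal (Ideal.span {c}) : ℕ) := by
    rw [← Ideal.span_singleton_mul_span_singleton, emultiplicity_mul hQ, ← Ideal.span_singleton_pow,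
      emultiplicity_pow hQ, ← hβ', emultiplicity_eq_zero.mpr hndvd, zero_add,
      hfc.emultiplicity_eq_multiplicity]
  rw [heq, e2] at e1
  have e3 : (h : ℕ) + p * multiplicity 𝔮.asIdeal (Ideal.span {a}) =
      p * multiplicity 𝔮.asIdeal (Ideal.span {c}) := by
    exact_mod_cast e1.symm
  exact (Nat.dvd_add_left (dvd_mul_right p _)).mp ⟨_, e3⟩

/-- **The Kummer witness `γ = (σβ)^{p+1} β^{p-1}` is not a `p`-th power in `K`** (`K` quadratic,
`σ ≠ 1`, `𝔮` a prime with `σ𝔮 ≠ 𝔮`, `h = orderOf [𝔮]` in `Cl(𝒪_K)`, `𝔮^h = (β)`, `p ≥ 3`): were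
`γ = y^p`, then `β a^p = σβ · c^p` in `𝒪_K`, so `p ∣ h` (`dvd_of_mul_pow_eq_mul_pow`), `h = p h'`,
`𝔮^{h'}(a) = (σ𝔮)^{h'}(c)` (unique factorisation), `[𝔮]^{h'} = [σ𝔮]^{h'} = [𝔮]^{-h'}` (Cox §7.B,
`[σ𝔮] = [𝔮]^{-1}`), so `h ∣ 2h'`, i.e. `p ∣ 2`. [cite: Cox2013, §7.B (the class of the conjugate
ideal is the inverse)] [cite: Marcus2018, Ch. 3, Thm. 25] -/
theorem not_exists_pow_eq_kummerWitness (h2 : finrank ℚ K = 2) (τ : K ≃ₐ[ℚ] K) (hτ : τ ≠ 1)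
    (𝔮 : HeightOneSpectrum (𝓞 K)) (hne : τ • 𝔮.asIdeal ≠ 𝔮.asIdeal) {β : 𝓞 K}
    (hβ : 𝔮.asIdeal ^ orderOf (ClassGroup.mk0 ⟨𝔮.asIdeal, mem_nonZeroDivisors_iff_ne_zero.mpr 𝔮.ne_bot⟩) =
      Ideal.span {β})
    {p : ℕ} (hp : p.Prime) (hp3 : 3 ≤ p) :
    ∀ y : K, y ^ p ≠ ((((τ • β) ^ (p + 1) * β ^ (p - 1) : 𝓞 K)) : K) := by
  intro y hy
  set h := orderOf (ClassGroup.mk0 ⟨𝔮.asIdeal, mem_nonZeroDivisors_iff_ne_zero.mpr 𝔮.ne_bot⟩) with hh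
  have hhpos : 0 < h := orderOf_pos _
  set β' : 𝓞 K := τ • β with hβ'def
  set γ : 𝓞 K := β' ^ (p + 1) * β ^ (p - 1) with hγ
  have hβ0 : β ≠ 0 := by
    intro h0
    have : 𝔮.asIdeal ^ h = ⊥ := by rw [hβ, h0, Ideal.span_singleton_eq_bot]
    exact pow_ne_zero h 𝔮.ne_bot this
  have hβ'0 : β' ≠ 0 := by
    intro h0; apply hβ0
    have := congrArg (fun x : 𝓞 K => τ⁻¹ • x) h0
    simpa only [hβ'def, inv_smul_smul, smul_zero] using this
  have hγ0 : γ ≠ 0 := mul_ne_zero (pow_ne_zero _ hβ'0) (pow_ne_zero _ hβ0)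
  -- the conjugate prime and its principal power
  let 𝔮' : HeightOneSpectrum (𝓞 K) :=
    ⟨τ • 𝔮.asIdeal, by haveI := 𝔮.isPrime; exact Ideal.IsPrime.smul τ,
      mem_nonZeroDivisors_iff_ne_zero.mp (smul_asIdeal_mem_nonZeroDivisors τ 𝔮)⟩
  have hβ' : 𝔮'.asIdeal ^ h = Ideal.span {β'} := by
    show (τ • 𝔮.asIdeal) ^ h = Ideal.span {τ • β}
    rw [← smul_pow', hβ, smul_span_singleton]
  -- `y = a / b`, `a^p = γ b^p` in `𝓞_K`
  obtain ⟨a, b, hb, rfl⟩ := IsFractionRing.div_surjective (A := 𝓞 K) y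
  have hb0 : b ≠ 0 := nonZeroDivisors.ne_zero hb
  have hbK : (b : K) ≠ 0 := RingOfIntegers.coe_ne_zero_iff.mpr hb0
  have hac : a ^ p = γ * b ^ p := by
    have h1 : ((a : K) / b) ^ p = (γ : K) := hy
    rw [div_pow, div_eq_iff (pow_ne_zero _ hbK)] at h1
    apply RingOfIntegers.coe_injective
    rw [map_pow, map_mul, map_pow]
    exact h1
  have ha0 : a ≠ 0 := by
    intro h0
    rw [h0, zero_pow hp.ne_zero] at hac
    exact mul_ne_zero hγ0 (pow_ne_zero _ hb0) hac.symm
  -- `β a^p = β' c^p` with `c = β β' b`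
  set c : 𝓞 K := β * β' * b with hcdef
  have hc0 : c ≠ 0 := mul_ne_zero (mul_ne_zero hβ0 hβ'0) hb0
  obtain ⟨p₁, hp₁⟩ : ∃ p₁, p = p₁ + 1 := ⟨p - 1, (Nat.sub_add_cancel hp.one_le).symm⟩
  have heq : β * a ^ p = β' * c ^ p := by
    rw [hac, hγ, hcdef, hp₁, Nat.add_sub_cancel]
    ring
  -- `p ∣ h`
  have hne' : 𝔮.asIdeal ≠ 𝔮'.asIdeal := fun h => hne h.symm
  have hph : p ∣ h := dvd_of_mul_pow_eq_mul_pow hne' hβ hβ' ha0 hc0 heq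
  obtain ⟨h', hh'⟩ := hph
  have hh'0 : h' ≠ 0 := by rintro rfl; rw [mul_zero] at hh'; omega
  -- `(𝔮^{h'} (a))^p = (𝔮'^{h'} (c))^p`, hence `𝔮^{h'} (a) = 𝔮'^{h'} (c)`
  have hJ : (𝔮.asIdeal ^ h' * Ideal.span {a}) ^ p = (𝔮'.asIdeal ^ h' * Ideal.span {c}) ^ p := by
    rw [mul_pow, mul_pow, ← pow_mul, ← pow_mul, mul_comm h' p, ← hh', hβ, hβ',
      Ideal.span_singleton_pow, Ideal.span_singleton_pow, Ideal.span_singleton_mul_span_singleton,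
      Ideal.span_singleton_mul_span_singleton, heq]
  have hJ0 : 𝔮.asIdeal ^ h' * Ideal.span {a} ≠ ⊥ :=
    mul_ne_zero (pow_ne_zero _ 𝔮.ne_bot) (Submodule.span_singleton_eq_bot.mp.mt ha0)
  have hJ'0 : 𝔮'.asIdeal ^ h' * Ideal.span {c} ≠ ⊥ :=
    mul_ne_zero (pow_ne_zero _ 𝔮'.ne_bot) (Submodule.span_singleton_eq_bot.mp.mt hc0)
  have hJeq := eq_of_pow_eq_pow_ideal hJ0 hJ'0 hp.ne_zero hJ
  -- classes: `[𝔮]^{h'} = [𝔮']^{h'}`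
  set Q : (Ideal (𝓞 K))⁰ := ⟨𝔮.asIdeal, mem_nonZeroDivisors_iff_ne_zero.mpr 𝔮.ne_bot⟩ with hQ
  set Q' : (Ideal (𝓞 K))⁰ := ⟨𝔮'.asIdeal, mem_nonZeroDivisors_iff_ne_zero.mpr 𝔮'.ne_bot⟩ with hQ'
  set A : (Ideal (𝓞 K))⁰ := ⟨Ideal.span {a}, mem_nonZeroDivisors_iff_ne_zero.mpr
    (Submodule.span_singleton_eq_bot.mp.mt ha0)⟩ with hA
  set C : (Ideal (𝓞 K))⁰ := ⟨Ideal.span {c}, mem_nonZeroDivisors_iff_ne_zero.mpr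
    (Submodule.span_singleton_eq_bot.mp.mt hc0)⟩ with hC
  have hJeq' : Q ^ h' * A = Q' ^ h' * C := by
    apply Subtype.ext
    simp only [Submonoid.coe_mul, SubmonoidClass.coe_pow]
    exact hJeq
  have hA1 : ClassGroup.mk0 A = 1 := (ClassGroup.mk0_eq_one_iff _).mpr ⟨⟨a, rfl⟩⟩
  have hC1 : ClassGroup.mk0 C = 1 := (ClassGroup.mk0_eq_one_iff _).mpr ⟨⟨c, rfl⟩⟩
  have hcl : ClassGroup.mk0 Q ^ h' = ClassGroup.mk0 Q' ^ h' := by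
    have := congrArg ClassGroup.mk0 hJeq'
    rwa [map_mul, map_mul, map_pow, map_pow, hA1, hC1, mul_one, mul_one] at this
  -- `[𝔮'] = [𝔮]⁻¹`, so `[𝔮]^{2h'} = 1`
  have hinv : ClassGroup.mk0 Q * ClassGroup.mk0 Q' = 1 := mk0_mul_mk0_smul_eq_one h2 τ hτ 𝔮
  have h2h : ClassGroup.mk0 Q ^ (2 * h') = 1 := by
    rw [two_mul, pow_add]
    nth_rewrite 2 [hcl]
    rw [← mul_pow, hinv, one_pow]
  have hdvd : h ∣ 2 * h' := by
    rw [hh]; exact orderOf_dvd_of_pow_eq_one h2h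
  rw [hh', mul_comm p h'] at hdvd
  have hp2 : p ∣ 2 := Nat.dvd_of_mul_dvd_mul_left (Nat.pos_of_ne_zero hh'0) (by rwa [mul_comm 2 h'] at hdvd)
  have := Nat.le_of_dvd two_pos hp2
  omega

end Literature.NumberTheory.QuadraticFields.RingClass
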